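import Summits.ResolutionOfSingularities.ResolutionOfSingularities.Theorems.SandwichedSingularitiesResolution
import Literature.AlgebraicGeometry.Resolution.BlowupsProduct
import Literature.AlgebraicGeometry.Resolution.BlowupsIntegral
import Literature.AlgebraicGeometry.Resolution.BlowupSequences
import Literature.AlgebraicGeometry.Resolution.BlowupsProperProofs
import Literature.AlgebraicGeometry.Resolution.BlowupsFlatBaseChange
import Literature.AlgebraicGeometry.Resolution.CanonicalResolutionProofs
import Literature.AlgebraicGeometry.Motives.Varieties
import HarnessLib.Audit
import HarnessLib

/-!
# Desingularization of blowings up of regular varieties: what Piltant's Axiom 4 gives, and what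
# the crux `PatchingRel` needs (line `sandwiched-gluing`, v3 cut, cycle 3) — CONJECTURES + one theorem

Crux `stmt-ResolutionOfSingularities-0642` (`Valuative.PatchingRel`). The v3 cut reduced Zariski's
patching, with no compactification, gluing or bad points, to the strong blow-up atom SAND⁺ᵇ(p)
(`SandwichedStrongBlowupResolution p`, leaf `Theorems/SandwichedSingularitiesResolution.lean`): a
sandwiched variety `V → U` (proper birational over a regular variety) admits a blowing up `Bl_J V`
with `V(J) ⊆ Sing V` and regular source. The basic sandwiched varieties are the blowings up
`V = Bl_I U` of regular varieties `U`, and for them Piltant's Axiom 4 (principalization of `I`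
on the regular `U`; Cossart–Piltant 2019, Prop. 4.4 in dimension three) already produces a
blow-up desingularization — but an EXCEPTIONAL-admissible one, `V(J) ⊆ η⁻¹ V(I)`, not a
Sing-admissible one. This file makes that precise:

* `PrincipalizationInChar p` — OPEN CONJECTURE (Axiom 4 in blow-up format, all dimensions): on a
  regular variety every non-zero ideal sheaf `I` is principalized by ONE blowing up `Bl_Q U`,
  `V(Q) ⊆ V(I)`, with regular source;
* `RegularBlowupExcAdmissibleResolution p` / `RegularBlowupSingAdmissibleResolution p` — OPEN
  CONJECTURES: every blowing up `V = Bl_I U` of a regular variety is desingularised by a blowing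
  up `Bl_J V` with `V(J)` inside the exceptional locus `η⁻¹ V(I)`, resp. inside `Sing V`;
* `regularBlowupExcAdmissibleResolution_of_principalization` — THEOREM (Stacks, Tag 080A read
  backwards): `PrincipalizationInChar p ⇒ RegularBlowupExcAdmissibleResolution p` — if
  `σ : Bl_Q U → U` principalizes `I` with regular source then `Bl_{η⁻¹Q} (Bl_I U) ≅ Bl_Q U`
  (both are `Bl_{IQ} U`), so `Bl_I U` is desingularised by the blowing up of `η⁻¹Q 𝒪`,
  cosupported in `η⁻¹ V(Q) ⊆ η⁻¹ V(I)`;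
* `regularBlowupSingAdmissibleResolution_of_sandwichedStrongBlowup`,
  `regularBlowupExcAdmissibleResolution_of_singAdmissible` — SAND⁺ᵇ(p) ⇒ Sing-admissible ⇒
  exceptional-admissible (`Sing (Bl_I U) ⊆ η⁻¹ V(I)`: the blowing up is an isomorphism off
  `V(I)` and `U` is regular).

So, for blowings up of regular varieties, the gap between what Axiom 4 gives
(exceptional-admissible) and what the crux consumes (Sing-admissible: the cosupport must avoid
the exceptional-but-regular points, whose closure in a proper model is where Zariski's bad points
live) is isolated as the implication `RegularBlowupExcAdmissibleResolution p →
RegularBlowupSingAdmissibleResolution p`, which this file does NOT claim.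

## References

* O. Piltant, *An axiomatic version of Zariski's patching theorem*, RACSAM 107 (2013) 91–121,
  §2 Axiom 4; Prop. 5.1 (proof, Steps 2–5); Def. 5.4 (bad points). [Piltant2013]
* V. Cossart, O. Piltant, *Resolution of singularities of arithmetical threefolds*, J. Algebra
  529 (2019) 268–535, Prop. 4.4 (principalization on regular threefolds). [CossartPiltant2019]
* The Stacks Project, Tag 080A (blowing up in a product of ideals). [StacksProject]
-/

-- `Summit.<Summit>.<Sub>[.Theorems]` with `Sub = Summit` (single-conjunct summit, D-0017): the duplicated
-- namespace component is the tree layout.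
set_option linter.dupNamespace false

noncomputable section

namespace Summit.ResolutionOfSingularities.ResolutionOfSingularities

open CategoryTheory AlgebraicGeometry TopologicalSpace
open Literature.AlgebraicGeometry.Resolution

universe u

/-- OPEN CONJECTURE — **principalization on regular varieties in blow-up format, characteristic
`p`** (Piltant 2013, §2, Axiom 4, on the regular model; Cossart–Piltant 2019, Prop. 4.4 proves the
dimension-three case as a composite of blowing ups with regular centres in the non-principal
loci): for a field `k` of characteristic `p`, a regular integral separated `k`-scheme of finite
type `U` and a non-zero ideal sheaf `I` on `U`, there is an ideal sheaf `Q` with `V(Q) ⊆ V(I)`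
whose blowing up `σ : Bl_Q U → U` has regular source and principalizes `I` (`I𝒪_{Bl_Q U}` is an
effective Cartier divisor). Known in dimension `≤ 3` (in every characteristic); OPEN in dimension
`≥ 4` for `p` prime [status: open]. Posed here (line `sandwiched-gluing`, v3 cut, of crux
stmt-ResolutionOfSingularities-0642). [cite: Piltant2013, §2 Axiom 4]
[cite: CossartPiltant2019, Prop. 4.4 (dimension 3)] -/
@[conjecture] def PrincipalizationInChar (p : ℕ) : Prop :=
  ∀ (k : Type u) [Field k] [CharP k p] (U : Scheme.{u}) (f : U ⟶ Spec (.of k)),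
    IsSeparated f → LocallyOfFiniteType f → QuasiCompact f → IsIntegral U → Scheme.IsRegular U →
    ∀ I : U.IdealSheafData, I ≠ ⊥ →
      ∃ (Q : U.IdealSheafData) (U' : Scheme.{u}) (σ : U' ⟶ U),
        (Q.support : Set U) ⊆ I.support ∧ IsBlowup σ Q ∧ Scheme.IsRegular U' ∧
          IsEffectiveCartier (I.comap σ)

/-- OPEN CONJECTURE — **exceptional-admissible blow-up desingularization of blowings up of
regular varieties, characteristic `p`**: for a regular integral separated `k`-scheme of finite
type `U` (`char k = p`), a non-zero ideal sheaf `I` and a blowing up `η : V → U` of `U` along `I`,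
there is a non-zero ideal sheaf `J` on `V`, cosupported in the exceptional locus `η⁻¹ V(I)`, whose
blowing up `Bl_J V` is regular. Implied by `PrincipalizationInChar p`
(`regularBlowupExcAdmissibleResolution_of_principalization`, Stacks 080A) and by the
Sing-admissible form; OPEN in dimension `≥ 4` [status: open]. [cite: Piltant2013, §2 Axiom 4]
[cite: StacksProject, Tag 080A] -/
@[conjecture] def RegularBlowupExcAdmissibleResolution (p : ℕ) : Prop :=
  ∀ (k : Type u) [Field k] [CharP k p] (U V : Scheme.{u}) (f : U ⟶ Spec (.of k)) (η : V ⟶ U)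
    (I : U.IdealSheafData),
    IsSeparated f → LocallyOfFiniteType f → QuasiCompact f → IsIntegral U → Scheme.IsRegular U →
    I ≠ ⊥ → IsBlowup η I →
      ∃ (J : V.IdealSheafData) (V' : Scheme.{u}) (π : V' ⟶ V),
        J ≠ ⊥ ∧ (J.support : Set V) ⊆ η ⁻¹' (I.support : Set U) ∧ IsBlowup π J ∧
          Scheme.IsRegular V'

/-- OPEN CONJECTURE — **Sing-admissible blow-up desingularization of blowings up of regular
varieties, characteristic `p`** (the strong atom SAND⁺ᵇ(p) of the line restricted to
`V = Bl_I U`): as `RegularBlowupExcAdmissibleResolution p` but with `J` cosupported in the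
SINGULAR locus of `V`. This is the form Zariski's patching consumes with no bad points
(`Theorems/ValuativePatchingRelStrongBlowup.lean`); it implies the exceptional-admissible form
(`Sing (Bl_I U) ⊆ η⁻¹ V(I)`) and is NOT known to follow from it (the difference is the set of
exceptional-but-regular points: Piltant 2013, Def. 5.4, bad points). OPEN in dimension `≥ 4`
[status: open]. [cite: Piltant2013, Def. 5.4 and Prop. 5.1] -/
@[conjecture] def RegularBlowupSingAdmissibleResolution (p : ℕ) : Prop :=
  ∀ (k : Type u) [Field k] [CharP k p] (U V : Scheme.{u}) (f : U ⟶ Spec (.of k)) (η : V ⟶ U)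
    (I : U.IdealSheafData),
    IsSeparated f → LocallyOfFiniteType f → QuasiCompact f → IsIntegral U → Scheme.IsRegular U →
    I ≠ ⊥ → IsBlowup η I →
      ∃ (J : V.IdealSheafData) (V' : Scheme.{u}) (π : V' ⟶ V),
        J ≠ ⊥ ∧ (∀ x : V, x ∈ J.support → ¬ IsRegularLocalRing (V.presheaf.stalk x)) ∧
          IsBlowup π J ∧ Scheme.IsRegular V'

namespace Theorems

/-- **Stacks 080A, read backwards: a principalization desingularises the blowing up.** If
`σ : U' → U` is a blowing up of `U` along `Q` with `U'` regular and `I𝒪_{U'}` an effective Cartier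
divisor, and `η : V → U` is a blowing up along `I`, then the blowing up of `V` along `η⁻¹Q 𝒪_V`
has regular source: composed with `η` it is the blowing up of `U` along `I · Q`
(`IsBlowup.comp`), as is `σ` (blowing up the effective Cartier divisor `I𝒪_{U'}` is the
identity, `IsBlowup.id`), so the two are isomorphic (`IsBlowup.unique`).
[cite: StacksProject, Tag 080A] -/
theorem exists_isBlowup_comap_isRegular {U U' V : Scheme.{u}} {I Q : U.IdealSheafData}
    {σ : U' ⟶ U} {η : V ⟶ U} (hσ : IsBlowup σ Q) (hreg : Scheme.IsRegular U')
    (hcart : IsEffectiveCartier (I.comap σ)) (hη : IsBlowup η I) :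
    ∃ (V' : Scheme.{u}) (π : V' ⟶ V), IsBlowup π (Q.comap η) ∧ Scheme.IsRegular V' := by
  -- `σ` is also the blowing up along `Q · I`
  have h1 : IsBlowup (𝟙 U' ≫ σ) (Q * I) := hσ.comp (IsBlowup.id hcart)
  rw [Category.id_comp] at h1
  -- the blowing up of `V` along `η⁻¹ Q` composed with `η` is the blowing up along `I · Q`
  let π : blowup (Q.comap η) ⟶ V := blowup.π (Q.comap η)
  have hπ : IsBlowup π (Q.comap η) := blowup.isBlowup _
  have h2 : IsBlowup (π ≫ η) (I * Q) := hη.comp hπ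
  rw [mul_comm] at h2
  -- uniqueness of blowing ups: `Bl_{η⁻¹Q} V ≅ U'`
  obtain ⟨e, -, -⟩ := h2.unique h1
  refine ⟨blowup (Q.comap η), π, hπ, fun x => ?_⟩
  haveI : IsRegularLocalRing (U'.presheaf.stalk (e.hom x)) := hreg (e.hom x)
  exact IsRegularLocalRing.of_ringEquiv (asIso (e.hom.stalkMap x)).commRingCatIsoToRingEquiv

/-- **Axiom 4 ⇒ exceptional-admissible desingularization of blowings up of regular varieties**:
`PrincipalizationInChar p → RegularBlowupExcAdmissibleResolution p`. The ideal is `J := η⁻¹Q 𝒪_V`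
for a principalization `Bl_Q U → U` of `I`; it is cosupported in `η⁻¹ V(Q) ⊆ η⁻¹ V(I)` and
non-zero because `V` has points over `U ∖ V(I)` (the blowing up is an isomorphism there).
[cite: StacksProject, Tag 080A] [cite: Piltant2013, §2 Axiom 4] -/
theorem regularBlowupExcAdmissibleResolution_of_principalization {p : ℕ}
    (hP : PrincipalizationInChar.{u} p) : RegularBlowupExcAdmissibleResolution.{u} p := by
  intro k _ _ U V f η I hf₁ hf₂ hf₃ hU hUreg hI hη
  haveI := hf₁; haveI := hf₂; haveI := hf₃; haveI := hU
  obtain ⟨Q, U', σ, hQI, hσ, hreg, hcart⟩ := hP k U f hf₁ hf₂ hf₃ hU hUreg I hI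
  obtain ⟨V', π, hπ, hreg'⟩ := exists_isBlowup_comap_isRegular hσ hreg hcart hη
  refine ⟨Q.comap η, V', π, ?_, ?_, hπ, hreg'⟩
  · -- `η⁻¹Q ≠ 0`: `V` has points over `U ∖ V(I) ⊆ U ∖ V(Q)`
    intro h
    have hsupp : ((Q.comap η).support : Set V) = Set.univ := by
      rw [h, Scheme.IdealSheafData.support_bot]; rfl
    rw [Scheme.IdealSheafData.support_comap] at hsupp
    obtain ⟨u, hu⟩ := centreCompl_nonempty (J := I) hI
    let W : U.Opens := ⟨(I.support : Set U)ᶜ, I.support.isClosed.isOpen_compl⟩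
    haveI : IsIso (η ∣_ W) := hη.isIso_compl
    obtain ⟨v, hv⟩ := (ConcreteCategory.bijective_of_isIso (η ∣_ W).base).2 ⟨u, hu⟩
    have hηv : η ((η ⁻¹ᵁ W).ι v) = u := by
      have := morphismRestrict_base_coe η W v
      rw [hv] at this
      exact this.symm
    have hmem : (η ⁻¹ᵁ W).ι v ∈ (TopologicalSpace.Closeds.preimage (Q.support) η.continuous :
        Set V) := by rw [hsupp]; trivial
    rw [TopologicalSpace.Closeds.coe_preimage, Set.mem_preimage, hηv] at hmem
    exact hu (hQI hmem)
  · intro v hv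
    rw [Scheme.IdealSheafData.support_comap] at hv
    exact hQI hv

/-- **The singular locus of a blowing up of a regular scheme lies in the exceptional locus**:
if `η : V → U` is a blowing up along `I` and `U` is regular, every singular point of `V` maps
into `V(I)` (off `V(I)` the blowing up is an isomorphism onto a regular open).
[cite: GortzWedhorn2020, Prop. 13.91 (3)] -/
theorem mem_preimage_support_of_not_isRegular {U V : Scheme.{u}} {I : U.IdealSheafData}
    {η : V ⟶ U} (hη : IsBlowup η I) (hUreg : Scheme.IsRegular U) {v : V}
    (hv : ¬ IsRegularLocalRing (V.presheaf.stalk v)) : η v ∈ (I.support : Set U) := by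
  by_contra h
  let W : U.Opens := ⟨(I.support : Set U)ᶜ, I.support.isClosed.isOpen_compl⟩
  haveI : IsIso (η ∣_ W) := hη.isIso_compl
  have := (mem_regularLocus_iff_of_isIso_morphismRestrict η W v h).mpr
    ((Scheme.mem_regularLocus _).mpr (hUreg _))
  exact hv ((Scheme.mem_regularLocus v).mp this)

/-- **Sing-admissible ⇒ exceptional-admissible** for blowings up of regular varieties.
[cite: GortzWedhorn2020, Prop. 13.91 (3)] -/
theorem regularBlowupExcAdmissibleResolution_of_singAdmissible {p : ℕ}
    (h : RegularBlowupSingAdmissibleResolution.{u} p) :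
    RegularBlowupExcAdmissibleResolution.{u} p := by
  intro k _ _ U V f η I hf₁ hf₂ hf₃ hU hUreg hI hη
  obtain ⟨J, V', π, hJ, hJsing, hπ, hreg⟩ := h k U V f η I hf₁ hf₂ hf₃ hU hUreg hI hη
  exact ⟨J, V', π, hJ, fun v hv => mem_preimage_support_of_not_isRegular hη hUreg (hJsing v hv),
    hπ, hreg⟩

/-- **SAND⁺ᵇ(p) ⇒ Sing-admissible desingularization of blowings up of regular varieties**: a
blowing up `Bl_I U → U` of an integral locally Noetherian `U` along `I ≠ 0` is proper and
birational with integral source, i.e. `Bl_I U` is a sandwiched variety. [folklore] -/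
theorem regularBlowupSingAdmissibleResolution_of_sandwichedStrongBlowup {p : ℕ}
    (h : SandwichedStrongBlowupResolution.{u} p) :
    RegularBlowupSingAdmissibleResolution.{u} p := by
  intro k _ _ U V f η I hf₁ hf₂ hf₃ hU hUreg hI hη
  haveI := hf₁; haveI := hf₂; haveI := hf₃; haveI := hU
  haveI : IsLocallyNoetherian U := LocallyOfFiniteType.isLocallyNoetherian f
  haveI : IsIntegral V := hη.isIntegral hI
  haveI : IsProper η := hη.isProper
  exact h k U V f η hf₁ hf₂ hf₃ hU hUreg inferInstance inferInstance (hη.isBirational' hI)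

/-- **Registered stub of line `sandwiched-gluing` (v3 cut, cycle 3)** (crux
stmt-ResolutionOfSingularities-0642, universe `0`): Axiom 4 in blow-up format gives
exceptional-admissible desingularization of blowings up of regular varieties.
[cite: StacksProject, Tag 080A] -/
theorem stub_regularBlowupExcAdmissible_of_principalization :
    ∀ p : ℕ, PrincipalizationInChar.{0} p → RegularBlowupExcAdmissibleResolution.{0} p :=
  fun _ hP => regularBlowupExcAdmissibleResolution_of_principalization hP

end Theorems

/-! ## The quasi-projective form: the atom the projective-models pipeline consumes

With PROJECTIVE models every morphism of models `φ : M → Y` is a blowing up of `Y` (Liu 2002,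
Thm. 8.1.24, vendored as `Literature.AlgebraicGeometry.Resolution.Liu2002Thm8124Projective`), so
the sandwiched piece `φ⁻¹(Reg Y) → Reg Y` of the line is LITERALLY a blowing up `Bl_I U` of the
regular quasi-projective variety `U = Reg Y`. The statement below is `RegularBlowupSingAdmissibleResolution`
restricted to quasi-projective `U`; `Theorems/ValuativePatchingRelRegularBlowupLine.lean` proves
`Liu2002Thm8124Projective → (∀ p prime, RegularBlowupSingAdmissibleResolutionQProj p) → PatchingRel`. -/

/-- OPEN CONJECTURE — **Sing-admissible blow-up desingularization of blowings up of regular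
QUASI-PROJECTIVE varieties, characteristic `p`**: for a field `k` of characteristic `p`, a
regular integral separated `k`-scheme of finite type `U` which is quasi-projective over `k` (an
open `k`-immersion into a `k`-scheme projective over `k`), a non-zero ideal sheaf `I` on `U` and a
blowing up `η : V → U` along `I`, there is a non-zero ideal sheaf `J` on `V`, cosupported in the
singular locus of `V`, whose blowing up `Bl_J V` is regular (for such `V`, quasi-projective, this
is "a projective resolution of `Bl_I U` which is an isomorphism over its regular locus", in
format). Together with Liu 2002 Thm. 8.1.24 it gives the crux `PatchingRel` (projective models
throughout); Piltant's Axiom 4 gives its exceptional-admissible twin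
(`regularBlowupExcAdmissibleResolution_of_principalization`). OPEN in dimension `≥ 4`
[status: open]. [cite: Piltant2013, p. 2 and Def. 5.4] [cite: Liu2002, Thm. 8.1.24 (use)] -/
@[conjecture] def RegularBlowupSingAdmissibleResolutionQProj (p : ℕ) : Prop :=
  ∀ (k : Type u) [Field k] [CharP k p] (U V : Scheme.{u}) (f : U ⟶ Spec (.of k)) (η : V ⟶ U)
    (I : U.IdealSheafData),
    IsSeparated f → LocallyOfFiniteType f → QuasiCompact f → IsIntegral U → Scheme.IsRegular U →
    (∃ (P : Scheme.{u}) (πP : P ⟶ Spec (.of k)) (j : U ⟶ P),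
      Literature.AlgebraicGeometry.Motives.IsProjectiveOver (Over.mk πP) ∧
        IsOpenImmersion j ∧ j ≫ πP = f) →
    I ≠ ⊥ → IsBlowup η I →
      ∃ (J : V.IdealSheafData) (V' : Scheme.{u}) (π : V' ⟶ V),
        J ≠ ⊥ ∧ (∀ x : V, x ∈ J.support → ¬ IsRegularLocalRing (V.presheaf.stalk x)) ∧
          IsBlowup π J ∧ Scheme.IsRegular V'

/-- The unrestricted form gives the quasi-projective one (forget the embedding). [folklore] -/
theorem regularBlowupSingAdmissibleResolutionQProj_of_singAdmissible {p : ℕ}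
    (h : RegularBlowupSingAdmissibleResolution.{u} p) :
    RegularBlowupSingAdmissibleResolutionQProj.{u} p :=
  fun k _ _ U V f η I h₁ h₂ h₃ h₄ h₅ _ hI hη => h k U V f η I h₁ h₂ h₃ h₄ h₅ hI hη

/-- Hence SAND⁺ᵇ(p) gives it too. [folklore] -/
theorem regularBlowupSingAdmissibleResolutionQProj_of_sandwichedStrongBlowup {p : ℕ}
    (h : SandwichedStrongBlowupResolution.{u} p) :
    RegularBlowupSingAdmissibleResolutionQProj.{u} p :=
  regularBlowupSingAdmissibleResolutionQProj_of_singAdmissible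
    (Theorems.regularBlowupSingAdmissibleResolution_of_sandwichedStrongBlowup h)

end Summit.ResolutionOfSingularities.ResolutionOfSingularities

end
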